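import Literature.Probability.RandomPlanarGeometry.SLERSObservableIto
import Literature.Probability.RandomPlanarGeometry.SLEPointSwallowingKernel
import HarnessLib

/-!
# `h(zₜ) = Im(θ zₜ^b)` and `Re(θ zₜ^b)` along the stopped SLE_κ point flow are martingales (Itô step of Lemma 6.5)

Topic `Probability/RandomPlanarGeometry`; theorems and two small definitions. The stochastic-calculus
core of S. Rohde, O. Schramm, *Basic properties of SLE*, Ann. of Math. 161 (2005), **Lemma 6.5**
(p. 907): "A direct calculation shows that the drift term in Itô's formula for `(gₜ(z) - ξ(t))^b` is
zero. Consequently, `h(gₜ(z) - ξ(t))` is a local martingale … Since `h(zₜ)` is a local martingale,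
and `h(z_{t∧τ*})` is bounded, `h(z_{t∧τ*})` is a martingale."

With the slope `w = x/y` of `zₜ = xₜ + i yₜ = gₜ(z) - √κ Bₜ` one has `θ zₜ^c = yₜ^c · θ(wₜ + i)^c`,
so for a `C²` function `F` of the slope satisfying the slope ODE
`(κ/2)(1+w²)F'' + 4wF' - 2bF = 0` (`swallowIm_ode`, `swallowRe_ode` of `SLEPointSwallowingKernel`
for `F = Im/Re(θ(·+i)^b)`, `b = 1 - 4/κ`) we prove, for every stopping time `σ` of the raw Brownian
filtration dominated by a localizing time `ρₙ = slePointLocTime κ z n` (`SLEPointFlow`) along which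
the slope stays bounded:

* `stoppedProcess_slePointIm_rpow_eq_integral` — the finite-variation factor
  `y^c_{t∧σ} = (im z)^c + ∫₀ᵗ 𝟙_{s≤σ} (-2c y_s^c/|z_s|²) ds` (pathwise, from `ẏ = -2y/|z|²`;
  `Loewner.im_centredMap_rpow_eq`);
* `exists_isItoIntegral_swallowObs` — **the observable `F(w_{t∧σ}) · y^b_{t∧σ}` is
  `F(re z/im z)(im z)^b` plus a square-integrable martingale Itô integral**, with the explicit
  integrand `swallowObsDiffusion = 𝟙_{s≤σ}(-√κ/y) F'(w) y^b` (product rule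
  `Literature.Analysis.FunctionSpaces.IsItoProcess.mul_timeIntegral` for `w = x · (1/y)`, Itô's
  formula `ito_formula_itoProcess_ae_holds` for `F(w)`, product rule `ae_mul_eq_of_isItoProcess`
  with `y^b`, and the drift algebra `swallowObs_itoDrift_eq_zero`); hence it is a martingale
  (`martingale_swallowObs`) with constant expectation (`integral_swallowObs`);
* `integral_sq_sub_eq_integral_sq_swallowObsDiffusion` — **second moment**: if moreover the
  observable is bounded, `E[(F(w_{t∧σ})y^b_{t∧σ} - F(w₀)y₀^b)²] = E ∫₀ᵗ (swallowObsDiffusion)² ds`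
  (Itô's formula for the square of the drift-free Itô process; the quadratic-variation identity
  that replaces the "sprint times" of the printed proof in the tree's argument).

## References

* S. Rohde, O. Schramm, *Basic properties of SLE*, Ann. of Math. 161 (2005), proof of Lemma 6.5
  (p. 907).
* D. Revuz, M. Yor, *Continuous Martingales and Brownian Motion* (1999), Ch. IV, Prop. (3.1),
  Thm (3.3).
-/

noncomputable section

open Set Filter MeasureTheory Complex intervalIntegral
open _root_.Topology
open scoped NNReal ENNReal

namespace Literature.Probability.RandomPlanarGeometry

open Loewner Literature.Probability.Process Literature.Analysis.FunctionSpaces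

/-! ### The finite-variation factor `y^c` (pathwise) -/

namespace Loewner

variable {W : ℝ≥0 → ℝ} {z : ℂ}

/-- **`yₜ^c = (Im z)^c - ∫₀ᵗ 2c yₛ^c/|zₛ|² ds`** for `z ∈ ℍ`, `t < T_z` and every real `c`
(`y = Im gₜ(z)` is `C¹`, positive, with `ẏ = -2y/|z|²`). [cite: RohdeSchramm2005, Lemma 6.5 (proof)] -/
theorem im_centredMap_rpow_eq (hW : Continuous W) (hz : 0 < z.im) (c : ℝ) {t : ℝ≥0}
    (ht : (t : WithTop ℝ≥0) < swallowingTime W z) :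
    (centredMap W t z).im ^ c = z.im ^ c +
      ∫ s in (0 : ℝ)..t, -(2 * c) * (centredMap W s.toNNReal z).im ^ c /
        ‖centredMap W s.toNNReal z‖ ^ 2 := by
  have hzW : z ≠ W 0 := ne_driving_of_im_pos hz 0
  obtain ⟨g, hg⟩ := exists_isSolution_swallowingTime_holds hW hzW
  have ht' : ((t : ℝ).toNNReal : WithTop ℝ≥0) < swallowingTime W z := by simpa using ht
  have hsub := Icc_subset_timeDomain ht'
  have hWc : Continuous fun s : ℝ ↦ (W s.toNNReal : ℂ) :=
    continuous_ofReal.comp (hW.comp continuous_real_toNNReal)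
  have hZ : ContinuousOn (fun s ↦ g s - (W s.toNNReal : ℂ)) (Icc 0 t) :=
    (hg.continuousOn.mono hsub).sub hWc.continuousOn
  have hne : ∀ s ∈ Icc (0 : ℝ) t, g s - (W s.toNNReal : ℂ) ≠ 0 := fun s hs ↦
    sub_ne_zero.2 (hg.ne hs.1 (hsub hs).2)
  have hpos : ∀ s ∈ Icc (0 : ℝ) t, 0 < (g s).im := fun s hs ↦
    IsSolution.im_pos_holds hW hg hz s hs.1 (hsub hs).2
  have him_eq : ∀ s, (g s - (W s.toNNReal : ℂ)).im = (g s).im := fun s ↦ by simp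
  set G : ℝ → ℝ := fun s ↦ ((g s).im) ^ c with hG
  set G' : ℝ → ℝ := fun s ↦ -(2 * c) * ((g s - W s.toNNReal).im) ^ c /
    ‖g s - (W s.toNNReal : ℂ)‖ ^ 2 with hG'
  have hcontIm : ContinuousOn (fun s ↦ (g s).im) (Icc 0 t) :=
    continuous_im.comp_continuousOn (hg.continuousOn.mono hsub)
  have hcont : ContinuousOn G (Icc 0 t) := hcontIm.rpow_const fun s hs ↦ Or.inl (hpos s hs).ne'
  have hderiv : ∀ s ∈ Ioo (0 : ℝ) t, HasDerivAt G (G' s) s := by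
    intro s hs
    have hsI : s ∈ Icc (0 : ℝ) t := ⟨hs.1.le, hs.2.le⟩
    have h1 := (hg.hasDerivAt_im_interior hs.1 (hsub hsI).2).rpow_const (p := c)
      (Or.inl (hpos s hsI).ne')
    refine h1.congr_deriv ?_
    simp only [hG', him_eq]
    have hy : (g s).im ≠ 0 := (hpos s hsI).ne'
    rw [Real.rpow_sub_one hy]
    field_simp
  have hcont' : ContinuousOn G' (Icc 0 t) := by
    refine ((continuousOn_const.mul ((continuous_im.comp_continuousOn hZ).rpow_const
      fun s hs ↦ Or.inl ?_)).div (hZ.norm.pow 2) ?_)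
    · simp only [Function.comp_apply, him_eq]; exact (hpos s hs).ne'
    · intro s hs
      exact pow_ne_zero 2 (norm_ne_zero_iff.2 (hne s hs))
  have hFTC := integral_eq_sub_of_hasDerivAt_of_le (NNReal.coe_nonneg t) hcont hderiv
    (hcont'.intervalIntegrable_of_Icc (NNReal.coe_nonneg t))
  have hcongr : ∫ s in (0 : ℝ)..t, -(2 * c) * (centredMap W s.toNNReal z).im ^ c /
      ‖centredMap W s.toNNReal z‖ ^ 2 = ∫ s in (0 : ℝ)..t, G' s := by
    refine integral_congr fun s hs ↦ ?_
    rw [uIcc_of_le (NNReal.coe_nonneg t)] at hs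
    have hsT : (s.toNNReal : WithTop ℝ≥0) < swallowingTime W z := (hsub hs).2
    simp only [hG']
    rw [centredMap_eq_of_isSolution hW hg hsT, Real.coe_toNNReal _ hs.1]
  have hG0 : G 0 = z.im ^ c := by simp [hG, hg.1]
  have hGt : (centredMap W t z).im = (g t).im := by
    rw [centredMap_eq_of_isSolution hW hg ht]; simp
  rw [hcongr, hFTC, hG0, hGt]
  simp only [hG]
  ring

end Loewner

/-- `-2c y^c/(x² + y²)`, the time derivative of `yₜ^c` along the flow. [cite: RohdeSchramm2005, Lemma 6.5 (proof)] -/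
def loewnerImRpowDrift (c x y : ℝ) : ℝ := -(2 * c) * y ^ c / (x ^ 2 + y ^ 2)

/-- Unfolding. [folklore] -/
theorem loewnerImRpowDrift_apply (c x y : ℝ) :
    loewnerImRpowDrift c x y = -(2 * c) * y ^ c / (x ^ 2 + y ^ 2) := rfl

/-- Joint measurability of the field. [folklore] -/
theorem measurable_loewnerImRpowDrift (c : ℝ) : Measurable (Function.uncurry (loewnerImRpowDrift c)) := by
  unfold loewnerImRpowDrift Function.uncurry
  exact ((measurable_const.mul (measurable_snd.pow_const c)).div
    ((measurable_fst.pow_const 2).add (measurable_snd.pow_const 2)))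

/-- Continuity of the field along continuous paths with `y > 0`. [folklore] -/
theorem continuous_loewnerImRpowDrift_comp (c : ℝ) {f g : ℝ → ℝ} (hf : Continuous f)
    (hg : Continuous g) (hpos : ∀ r, 0 < g r) :
    Continuous fun r ↦ loewnerImRpowDrift c (f r) (g r) := by
  unfold loewnerImRpowDrift
  refine (continuous_const.mul (hg.rpow_const fun r ↦ Or.inl (hpos r).ne')).div
    ((hf.pow 2).add (hg.pow 2)) fun r ↦ ?_
  have := hpos r
  positivity

section Stopped

variable {κ : ℝ≥0} {z : ℂ} {n : ℕ} {σ : (ℝ≥0 → ℝ) → WithTop ℝ≥0}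

/-- **`y^c_{t∧σ} = (im z)^c + ∫₀ᵗ 𝟙_{s≤σ} (-2c y_s^c/|z_s|²) ds`** (pathwise, `σ ≤ ρₙ`, every real
`c`): `Loewner.im_centredMap_rpow_eq` read at the stopped clock. [cite: RohdeSchramm2005, Lemma 6.5 (proof)] -/
theorem stoppedProcess_slePointIm_rpow_eq_integral (hz : 0 < z.im)
    (hσρ : ∀ ω, σ ω ≤ slePointLocTime κ z n ω) (c : ℝ) (t : ℝ≥0) (ω : ℝ≥0 → ℝ) :
    stoppedProcess (slePointIm κ z) σ t ω ^ c =
      z.im ^ c + timeIntegral (trunc σ fun s ω ↦ loewnerImRpowDrift c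
        (stoppedProcess (slePointRe κ z) σ s ω) (stoppedProcess (slePointIm κ z) σ s ω)) t ω := by
  set u : ℝ≥0 := (min (t : WithTop ℝ≥0) (σ ω)).untopA with hu
  have hW := continuous_sleDriving κ ω
  have huT := coe_untopA_min_lt_swallowingTime hz hσρ t ω
  have hint : timeIntegral (trunc σ fun s ω ↦ loewnerImRpowDrift c (stoppedProcess (slePointRe κ z) σ s ω)
      (stoppedProcess (slePointIm κ z) σ s ω)) t ω =
      ∫ r in (0 : ℝ)..u, -(2 * c) * (centredMap (sleDriving κ ω) r.toNNReal z).im ^ c /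
        ‖centredMap (sleDriving κ ω) r.toNNReal z‖ ^ 2 := by
    rw [timeIntegral_trunc]
    simp only [timeIntegral]
    refine intervalIntegral.integral_congr fun r hr ↦ ?_
    rw [uIcc_of_le (NNReal.coe_nonneg _)] at hr
    have hrσ : ((r.toNNReal : ℝ≥0) : WithTop ℝ≥0) ≤ σ ω := coe_toNNReal_le_of_le_untopA_min hr.2
    have hrT := coe_lt_swallowingTime_of_le_locTime hz (hrσ.trans (hσρ ω))
    simp only [stoppedProcess_eq_of_le hrσ, loewnerImRpowDrift_apply]
    rw [slePointIm_of_lt hrT, slePointRe, re_sq_add_im_sq_eq_norm_sq]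
  rw [hint, stoppedProcess_slePointIm_eq hz hσρ, ← hu, im_centredMap_rpow_eq hW hz c huT]

/-- The drift path `r ↦ 𝟙_{r≤σ} (-2c y^c/|z|²)` is locally integrable (continuous integrand).
[folklore] -/
theorem integrableOn_trunc_loewnerImRpowDrift (hz : 0 < z.im)
    (hσρ : ∀ ω, σ ω ≤ slePointLocTime κ z n ω) (c : ℝ) (ω : ℝ≥0 → ℝ) (S : Set ℝ) (hS : IsCompact S) :
    IntegrableOn (fun r : ℝ ↦ trunc σ (fun s ω ↦ loewnerImRpowDrift c
      (stoppedProcess (slePointRe κ z) σ s ω) (stoppedProcess (slePointIm κ z) σ s ω)) r.toNNReal ω) S :=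
  integrableOn_trunc ((continuous_loewnerImRpowDrift_comp c
    ((continuous_stoppedProcess_slePointRe hz hσρ ω).comp continuous_real_toNNReal)
    ((continuous_stoppedProcess_slePointIm hz σ ω).comp continuous_real_toNNReal)
    fun _ ↦ stoppedProcess_slePointIm_pos hz hσρ _ ω).continuousOn.integrableOn_compact hS)

end Stopped

/-! ### The drift of `F(w) y^b` vanishes: the algebra behind "the drift term is zero" -/

/-- **The Itô drift of `y^b F(x/y)` vanishes** given the slope ODE for `F` at `w = x/y`: with
`dx = (2x/|z|²)dt - √κ dB`, `d(1/y) = 2/(y|z|²) dt`, `d(y^b) = -2b y^b/|z|² dt`, `dw = x d(1/y) + (1/y) dx`,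
the `dt`-coefficient of `d(F(w) y^b)`,
`F(w)·(-2b y^b/|z|²) + y^b[(x·2/(y|z|²) + (1/y)·2x/|z|²) F'(w) + ½ (√κ/y)² F''(w)]`, equals
`(y^{b-2}/(1+w²))[(κ/2)(1+w²)F'' + 4wF' - 2bF](w) = 0` (`|z|² = y²(1+w²)`).
[cite: RohdeSchramm2005, Lemma 6.5 (proof)] -/
theorem swallowObs_itoDrift_eq_zero (κ : ℝ≥0) {b x y : ℝ} {F : ℝ → ℝ} (hy : 0 < y)
    (hode : (κ : ℝ) / 2 * (1 + (x * y⁻¹) ^ 2) * iteratedDeriv 2 F (x * y⁻¹) +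
      4 * (x * y⁻¹) * deriv F (x * y⁻¹) - 2 * b * F (x * y⁻¹) = 0) :
    F (x * y⁻¹) * loewnerImRpowDrift b x y +
      y ^ b * ((x * loewnerInvImDrift x y + y⁻¹ * loewnerReDrift x y) * deriv F (x * y⁻¹) +
        2⁻¹ * (-Real.sqrt κ * y⁻¹) ^ 2 * iteratedDeriv 2 F (x * y⁻¹)) = 0 := by
  obtain ⟨w, rfl⟩ : ∃ w, x = w * y := ⟨x * y⁻¹, by field_simp⟩
  have hy0 : y ≠ 0 := hy.ne'
  have hw : w * y * y⁻¹ = w := mul_inv_cancel_right₀ hy0 w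
  rw [hw] at hode ⊢
  set h0 := F w
  set h1 := deriv F w
  set h2 := iteratedDeriv 2 F w
  have h1w : (1 + w ^ 2) ≠ 0 := by positivity
  have hsq : (-Real.sqrt κ * y⁻¹) ^ 2 = (κ : ℝ) * y⁻¹ ^ 2 := by
    rw [mul_pow, neg_sq, Real.sq_sqrt κ.coe_nonneg]
  have hyb : 0 < y ^ b := Real.rpow_pos_of_pos hy b
  have key : h0 * loewnerImRpowDrift b (w * y) y +
      y ^ b * ((w * y * loewnerInvImDrift (w * y) y + y⁻¹ * loewnerReDrift (w * y) y) * h1 +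
        2⁻¹ * (-Real.sqrt κ * y⁻¹) ^ 2 * h2) =
      y ^ b / (y ^ 2 * (1 + w ^ 2)) * ((κ : ℝ) / 2 * (1 + w ^ 2) * h2 + 4 * w * h1 - 2 * b * h0) := by
    rw [hsq, loewnerImRpowDrift_apply, loewnerInvImDrift_apply, loewnerReDrift_apply]
    have hN : (w * y) ^ 2 + y ^ 2 = y ^ 2 * (1 + w ^ 2) := by ring
    rw [hN]
    field_simp
    ring
  rw [key, hode, mul_zero]

/-! ### The observable `F(w) y^b` stopped before swallowing -/

section Main

variable (κ : ℝ≥0) (z : ℂ) (σ : (ℝ≥0 → ℝ) → WithTop ℝ≥0) (F : ℝ → ℝ) (b : ℝ)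

/-- The observable **`F(w_{t∧σ}) · y^b_{t∧σ}`** (`w = x/y` the slope of `z_{t∧σ} = g(z) - √κ B`),
`yₜ^b · F(xₜ/yₜ)`; for `F = swallowIm b` this is Rohde–Schramm's `h(z_{t∧σ}) = Im(θ z_{t∧σ}^b)`.
[cite: RohdeSchramm2005, Lemma 6.5 (proof)] -/
def swallowObs (t : ℝ≥0) (ω : ℝ≥0 → ℝ) : ℝ :=
  F (stoppedProcess (slePointRe κ z) σ t ω * (stoppedProcess (slePointIm κ z) σ t ω)⁻¹) *
    stoppedProcess (slePointIm κ z) σ t ω ^ b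

/-- The diffusion coefficient **`𝟙_{t≤σ}(-√κ) · y⁻¹ · F'(w) · y^b`** of the observable.
[cite: RohdeSchramm2005, Lemma 6.5 (proof)] -/
def swallowObsDiffusion (t : ℝ≥0) (ω : ℝ≥0 → ℝ) : ℝ :=
  trunc σ (fun _ _ ↦ -Real.sqrt κ) t ω * (stoppedProcess (slePointIm κ z) σ t ω)⁻¹ *
    deriv F (stoppedProcess (slePointRe κ z) σ t ω * (stoppedProcess (slePointIm κ z) σ t ω)⁻¹) *
    stoppedProcess (slePointIm κ z) σ t ω ^ b

variable {κ z σ F b} {n : ℕ}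

/-- The observable at time `0` is `F(re z/im z) (im z)^b`. [folklore] -/
theorem swallowObs_zero (hz : 0 < z.im) (ω : ℝ≥0 → ℝ) :
    swallowObs κ z σ F b 0 ω = F (z.re / z.im) * z.im ^ b := by
  simp only [swallowObs]
  rw [stoppedProcess_slePointRe_zero hz, stoppedProcess_slePointIm_zero hz, div_eq_mul_inv]

/-- **The observable is `F(re z/im z)(im z)^b` plus a martingale Itô integral of
`swallowObsDiffusion`.** Let `κ > 0`, `z ∈ ℍ`, `F ∈ C²(ℝ)` satisfy the slope ODE
`(κ/2)(1+w²)F'' + 4wF' - 2bF = 0`, and let `σ` be a stopping time of the raw Brownian filtration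
with `σ ≤ ρₙ = slePointLocTime κ z n` along which the slope is bounded by `S`. Then there is an Itô
integral `K = ∫ swallowObsDiffusion dB`, a martingale, with a.s. for all `t`,
`F(w_{t∧σ}) y^b_{t∧σ} = F(re z/im z)(im z)^b + K_t`. ("The drift term in Itô's formula for
`(gₜ(z) - ξ(t))^b` is zero … `h(z_{t∧τ*})` is a martingale", p. 907.)
[cite: RohdeSchramm2005, Lemma 6.5 (proof)] -/
theorem exists_isItoIntegral_swallowObs (hκ : 0 < κ) (hz : 0 < z.im) (hF : ContDiff ℝ 2 F)
    (hode : ∀ w : ℝ, (κ : ℝ) / 2 * (1 + w ^ 2) * iteratedDeriv 2 F w + 4 * w * deriv F w -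
      2 * b * F w = 0)
    (hσ : IsStoppingTime brownianFiltration σ) (hσρ : ∀ ω, σ ω ≤ slePointLocTime κ z n ω)
    {S : ℝ} (hS : ∀ (ω : ℝ≥0 → ℝ) (t : ℝ≥0), (t : WithTop ℝ≥0) ≤ σ ω →
      |cotArg (sleDriving κ ω) z t| ≤ S) :
    ∃ K : ℝ≥0 → (ℝ≥0 → ℝ) → ℝ,
      IsItoIntegral (swallowObsDiffusion κ z σ F b) brownian K brownianFiltration preWienerMeasure ∧
      Martingale K brownianFiltration preWienerMeasure ∧
      ∀ᵐ ω ∂preWienerMeasure, ∀ t : ℝ≥0,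
        swallowObs κ z σ F b t ω = F (z.re / z.im) * z.im ^ b + K t ω := by
  haveI := isProbabilityMeasure_preWienerMeasure'
  have hκ0 : (0 : ℝ) < κ := by exact_mod_cast hκ
  have hσ' : ∀ t : ℝ≥0, MeasurableSet[brownianFiltration t] {ω | σ ω < t} :=
    fun t ↦ hσ.measurableSet_lt t
  have hl0 : 0 < z.im / (n + 2) := (level_pos_lt hz n).1
  -- the processes
  set X : ℝ≥0 → (ℝ≥0 → ℝ) → ℝ := stoppedProcess (slePointRe κ z) σ with hXdef
  set Y : ℝ≥0 → (ℝ≥0 → ℝ) → ℝ := stoppedProcess (slePointIm κ z) σ with hYdef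
  set A : ℝ≥0 → (ℝ≥0 → ℝ) → ℝ := fun t ω ↦ (Y t ω)⁻¹ with hAdef
  set w : ℝ≥0 → (ℝ≥0 → ℝ) → ℝ := fun t ω ↦ X t ω * A t ω with hwdef
  set Φ : ℝ≥0 → (ℝ≥0 → ℝ) → ℝ := fun t ω ↦ Y t ω ^ b with hΦdef
  set σB : ℝ≥0 → (ℝ≥0 → ℝ) → ℝ := trunc σ (fun _ _ ↦ -Real.sqrt κ) with hσBdef
  set bX : ℝ≥0 → (ℝ≥0 → ℝ) → ℝ := trunc σ (fun s ω ↦ loewnerReDrift (X s ω) (Y s ω)) with hbXdef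
  set aA : ℝ≥0 → (ℝ≥0 → ℝ) → ℝ := trunc σ (fun s ω ↦ loewnerInvImDrift (X s ω) (Y s ω)) with haAdef
  set aΦ : ℝ≥0 → (ℝ≥0 → ℝ) → ℝ := trunc σ (fun s ω ↦ loewnerImRpowDrift b (X s ω) (Y s ω)) with haΦdef
  set bw : ℝ≥0 → (ℝ≥0 → ℝ) → ℝ := fun t ω ↦ X t ω * aA t ω + A t ω * bX t ω with hbwdef
  set σw : ℝ≥0 → (ℝ≥0 → ℝ) → ℝ := fun t ω ↦ σB t ω * A t ω with hσwdef
  set D1 : ℝ≥0 → (ℝ≥0 → ℝ) → ℝ := fun t ω ↦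
    bw t ω * deriv F (w t ω) + 2⁻¹ * σw t ω ^ 2 * iteratedDeriv 2 F (w t ω) with hD1def
  set σG : ℝ≥0 → (ℝ≥0 → ℝ) → ℝ := fun t ω ↦ σw t ω * deriv F (w t ω) with hσGdef
  -- pathwise values and bounds
  have hYpos : ∀ t ω, 0 < Y t ω := fun t ω ↦ stoppedProcess_slePointIm_pos hz hσρ t ω
  have hYlev : ∀ t ω, z.im / (n + 2) ≤ Y t ω := fun t ω ↦ level_le_stoppedProcess_slePointIm hz hσρ t ω
  have hYle : ∀ t ω, Y t ω ≤ z.im := fun t ω ↦ stoppedProcess_slePointIm_le hz hσρ t ω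
  have hwcot : ∀ t ω, w t ω = cotArg (sleDriving κ ω) z ((min (t : WithTop ℝ≥0) (σ ω)).untopA) :=
    fun t ω ↦ by rw [← stopped_div_eq_cotArg hz hσρ t ω, div_eq_mul_inv]
  have hwS : ∀ t ω, |w t ω| ≤ S := fun t ω ↦ by
    rw [hwcot]; exact hS ω _ (coe_untopA_min_le t (σ ω))
  have hS0 : 0 ≤ S := (abs_nonneg _).trans (hwS 0 fun _ ↦ 0)
  have hwmem : ∀ t ω, w t ω ∈ Icc (-S) S := fun t ω ↦ abs_le.1 (hwS t ω)
  have hXbd : ∀ t ω, |X t ω| ≤ S * z.im := fun t ω ↦ by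
    have hx : X t ω = w t ω * Y t ω := by
      simp only [hwdef, hAdef]; rw [inv_mul_cancel_right₀ (hYpos t ω).ne']
    rw [hx, abs_mul, abs_of_pos (hYpos t ω)]
    exact mul_le_mul (hwS t ω) (hYle t ω) (hYpos t ω).le hS0
  have hAbd : ∀ t ω, |A t ω| ≤ (n + 2) / z.im := fun t ω ↦ by
    simp only [hAdef]
    rw [abs_of_pos (inv_pos.2 (hYpos t ω)), inv_eq_one_div, div_le_div_iff₀ (hYpos t ω) hz, one_mul]
    have := hYlev t ω
    rw [div_le_iff₀ (by positivity : (0 : ℝ) < n + 2)] at this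
    linarith
  have hσBbd : ∀ t ω, |σB t ω| ≤ Real.sqrt κ := fun t ω ↦ by
    simp only [hσBdef, trunc_apply]
    split_ifs
    · rw [abs_neg, abs_of_nonneg (Real.sqrt_nonneg _)]
    · rw [abs_zero]; exact Real.sqrt_nonneg _
  -- bounds for `y^b`: between `min (im z)^b ((im z/(n+2))^b)` and their `max`
  set CΦ : ℝ := max (z.im ^ b) ((z.im / (n + 2)) ^ b) with hCΦdef
  have hΦpos : ∀ t ω, 0 < Φ t ω := fun t ω ↦ Real.rpow_pos_of_pos (hYpos t ω) b
  have hΦbd : ∀ t ω, |Φ t ω| ≤ CΦ := fun t ω ↦ by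
    simp only [hΦdef]
    rw [abs_of_pos (Real.rpow_pos_of_pos (hYpos t ω) b)]
    rcases le_total 0 b with hb | hb
    · exact (Real.rpow_le_rpow (hYpos t ω).le (hYle t ω) hb).trans (le_max_left _ _)
    · exact (Real.rpow_le_rpow_of_nonpos hl0 (hYlev t ω) hb).trans (le_max_right _ _)
  -- bounds for `F, F', F''` on `[-S, S]`
  have hc0 : Continuous F := hF.continuous
  have hc1 : Continuous (deriv F) := hF.continuous_deriv (by norm_num)
  have hc2 : Continuous (iteratedDeriv 2 F) := hF.continuous_iteratedDeriv 2 le_rfl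
  obtain ⟨C0, hC0⟩ : ∃ C, ∀ v ∈ Icc (-S) S, |F v| ≤ C := by
    obtain ⟨C, hC⟩ := isCompact_Icc.exists_bound_of_continuousOn hc0.continuousOn
    exact ⟨C, fun v hv ↦ by simpa [Real.norm_eq_abs] using hC v hv⟩
  obtain ⟨C1, hC1⟩ : ∃ C, ∀ v ∈ Icc (-S) S, |deriv F v| ≤ C := by
    obtain ⟨C, hC⟩ := isCompact_Icc.exists_bound_of_continuousOn hc1.continuousOn
    exact ⟨C, fun v hv ↦ by simpa [Real.norm_eq_abs] using hC v hv⟩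
  have hC00 : 0 ≤ C0 := (abs_nonneg _).trans (hC0 _ (hwmem 0 fun _ ↦ 0))
  have hC10 : 0 ≤ C1 := (abs_nonneg _).trans (hC1 _ (hwmem 0 fun _ ↦ 0))
  -- path regularity
  have hXc : ∀ ω, Continuous (X · ω) := fun ω ↦ continuous_stoppedProcess_slePointRe hz hσρ ω
  have hYc : ∀ ω, Continuous (Y · ω) := fun ω ↦ continuous_stoppedProcess_slePointIm hz σ ω
  have hAc : ∀ ω, Continuous (A · ω) := fun ω ↦ (hYc ω).inv₀ fun t ↦ (hYpos t ω).ne'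
  have hwc : ∀ ω, Continuous (w · ω) := fun ω ↦ (hXc ω).mul (hAc ω)
  have hΦc : ∀ ω, Continuous (Φ · ω) := fun ω ↦ (hYc ω).rpow_const fun t ↦ Or.inl (hYpos t ω).ne'
  have hGc : ∀ ω, Continuous (fun t ↦ F (w t ω)) := fun ω ↦ hc0.comp (hwc ω)
  -- adaptedness and progressive measurability
  have hXa : StronglyAdapted brownianFiltration X := stronglyAdapted_stoppedProcess_slePointRe hz hσ
  have hYa : StronglyAdapted brownianFiltration Y := stronglyAdapted_stoppedProcess_slePointIm hz hσ
  have hAa : StronglyAdapted brownianFiltration A := fun t ↦ (hYa t).measurable.inv.stronglyMeasurable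
  have hwa : StronglyAdapted brownianFiltration w := fun t ↦ (hXa t).mul (hAa t)
  have hΦa : StronglyAdapted brownianFiltration Φ := fun t ↦
    ((hYa t).measurable.pow_const b).stronglyMeasurable
  have hGa : StronglyAdapted brownianFiltration fun t ω ↦ F (w t ω) := fun t ↦
    hc0.comp_stronglyMeasurable (hwa t)
  have hXp : IsStronglyProgressive brownianFiltration X := hXa.isStronglyProgressive_of_continuous hXc
  have hYp : IsStronglyProgressive brownianFiltration Y := hYa.isStronglyProgressive_of_continuous hYc
  have hAp : IsStronglyProgressive brownianFiltration A := hAa.isStronglyProgressive_of_continuous hAc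
  have hwp : IsStronglyProgressive brownianFiltration w := hXp.mul hAp
  have hΦp : IsStronglyProgressive brownianFiltration Φ := hΦa.isStronglyProgressive_of_continuous hΦc
  have hGp : IsStronglyProgressive brownianFiltration fun t ω ↦ F (w t ω) :=
    IsStronglyProgressive.continuous_comp hwp hc0
  have hG1p : IsStronglyProgressive brownianFiltration fun t ω ↦ deriv F (w t ω) :=
    IsStronglyProgressive.continuous_comp hwp hc1
  have hσBp : IsStronglyProgressive brownianFiltration σB :=
    isStronglyProgressive_trunc (isStronglyProgressive_const _ _) hσ'
  have hbXp : IsStronglyProgressive brownianFiltration bX :=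
    isStronglyProgressive_trunc (isStronglyProgressive_comp_pair hXp hYp measurable_loewnerReDrift) hσ'
  have haAp : IsStronglyProgressive brownianFiltration aA :=
    isStronglyProgressive_trunc (isStronglyProgressive_comp_pair hXp hYp measurable_loewnerInvImDrift) hσ'
  have hσwp : IsStronglyProgressive brownianFiltration σw := hσBp.mul hAp
  have hσGp : IsStronglyProgressive brownianFiltration σG := hσwp.mul hG1p
  have hσwbd : ∀ t ω, |σw t ω| ≤ Real.sqrt κ * ((n + 2) / z.im) := fun t ω ↦ by
    simp only [hσwdef]; rw [abs_mul]
    exact mul_le_mul (hσBbd t ω) (hAbd t ω) (abs_nonneg _) (Real.sqrt_nonneg _)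
  have hσGbd : ∀ t ω, |σG t ω| ≤ Real.sqrt κ * ((n + 2) / z.im) * C1 := fun t ω ↦ by
    simp only [hσGdef]; rw [abs_mul]
    exact mul_le_mul (hσwbd t ω) (hC1 _ (hwmem t ω)) (abs_nonneg _) (by positivity)
  ---------------------------------------------------------------------------
  -- Step 1: `x^σ` is an Itô process
  have hX : IsItoProcess X bX σB brownian brownianFiltration preWienerMeasure :=
    isItoProcess_stoppedProcess_slePointRe hz hσ hσρ
  ---------------------------------------------------------------------------
  -- Step 2: `w = x · (1/y)` is an Itô process (product rule)
  obtain ⟨KX, hKX, hKXM⟩ := exists_isItoIntegral_of_abs_le (hσBp.mul hXp)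
    (C := Real.sqrt κ * (S * z.im)) fun t ω ↦ by
      rw [abs_mul]; exact mul_le_mul (hσBbd t ω) (hXbd t ω) (abs_nonneg _) (Real.sqrt_nonneg _)
  obtain ⟨K, hK, hKM⟩ := exists_isItoIntegral_of_abs_le (hσBp.mul hAp)
    (C := Real.sqrt κ * ((n + 2) / z.im)) fun t ω ↦ by
      rw [abs_mul]; exact mul_le_mul (hσBbd t ω) (hAbd t ω) (abs_nonneg _) (Real.sqrt_nonneg _)
  have hA0 : ∀ ω, A 0 ω = (z.im)⁻¹ := fun ω ↦ by
    simp only [hAdef, hYdef]; rw [stoppedProcess_slePointIm_zero hz]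
  have hAeq : ∀ᵐ ω ∂preWienerMeasure, ∀ t : ℝ≥0, A t ω = A 0 ω + ∫ s in (0 : ℝ)..t, aA s.toNNReal ω :=
    ae_of_all _ fun ω t ↦ by
      rw [hA0]
      exact inv_stoppedProcess_slePointIm_eq_integral hz hσρ t ω
  have haA : ∀ᵐ ω ∂preWienerMeasure, ∀ t : ℝ≥0,
      IntegrableOn (fun s : ℝ ↦ aA s.toNNReal ω) (Icc 0 t) :=
    ae_of_all _ fun ω t ↦ integrableOn_trunc_loewnerInvImDrift hz hσρ ω _ isCompact_Icc
  have hw : IsItoProcess w bw σw brownian brownianFiltration preWienerMeasure :=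
    IsItoProcess.mul_timeIntegral hXa hXc hσBp hX hAa hAc hAeq haA hKX hKXM hK hKM
  ---------------------------------------------------------------------------
  -- Step 3: `F(w)` is an Itô process (Itô's formula)
  obtain ⟨Kw, hKw, hKwM⟩ := exists_isItoIntegral_of_abs_le hσGp hσGbd
  have hf' : ContDiff ℝ 2 (Function.uncurry fun (_ : ℝ) (v : ℝ) ↦ F v) := hF.comp contDiff_snd
  have hito := ito_formula_itoProcess_ae_holds (fun (_ : ℝ) (v : ℝ) ↦ F v) hf'
    (fun t ↦ (hwa t).measurable) hσwp hw (K := Kw) (by exact hKw)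
  have hGint := hw.ae_integrableOn_itoDrift hf' hσwp
  have hG : IsItoProcess (fun t ω ↦ F (w t ω)) D1 σG brownian brownianFiltration preWienerMeasure := by
    refine ⟨?_, Kw, hKw, ?_⟩
    · filter_upwards [hGint] with ω hω t
      have h1 := hω t
      simp only [deriv_const, zero_add] at h1
      exact h1
    · filter_upwards [hito] with ω hω t
      have h1 := hω t
      simp only [deriv_const, zero_add] at h1
      exact h1
  ---------------------------------------------------------------------------
  -- Step 4: the product `F(w) y^b` (product rule again)
  obtain ⟨KX', hKX', hKX'M⟩ := exists_isItoIntegral_of_abs_le (hσGp.mul hGp)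
    (C := Real.sqrt κ * ((n + 2) / z.im) * C1 * C0) fun t ω ↦ by
      rw [abs_mul]; exact mul_le_mul (hσGbd t ω) (hC0 _ (hwmem t ω)) (abs_nonneg _) (by positivity)
  obtain ⟨K', hK', hK'M⟩ := exists_isItoIntegral_of_abs_le (hσGp.mul hΦp)
    (C := Real.sqrt κ * ((n + 2) / z.im) * C1 * CΦ) fun t ω ↦ by
      rw [abs_mul]; exact mul_le_mul (hσGbd t ω) (hΦbd t ω) (abs_nonneg _) (by positivity)
  have hΦ0 : ∀ ω, Φ 0 ω = z.im ^ b := fun ω ↦ by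
    simp only [hΦdef, hYdef]; rw [stoppedProcess_slePointIm_zero hz]
  have hΦeq : ∀ᵐ ω ∂preWienerMeasure, ∀ t : ℝ≥0, Φ t ω = Φ 0 ω + ∫ s in (0 : ℝ)..t, aΦ s.toNNReal ω :=
    ae_of_all _ fun ω t ↦ by
      rw [hΦ0]
      exact stoppedProcess_slePointIm_rpow_eq_integral hz hσρ b t ω
  have haΦ : ∀ᵐ ω ∂preWienerMeasure, ∀ t : ℝ≥0,
      IntegrableOn (fun s : ℝ ↦ aΦ s.toNNReal ω) (Icc 0 t) :=
    ae_of_all _ fun ω t ↦ integrableOn_trunc_loewnerImRpowDrift hz hσρ b ω _ isCompact_Icc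
  have hprod := ae_mul_eq_of_isItoProcess hGa hGc hσGp hG hΦa hΦc hΦeq haΦ hKX' hKX'M hK' hK'M
  ---------------------------------------------------------------------------
  -- Step 5: the drift of `F(w) y^b` vanishes identically, by the slope ODE
  have hdrift : ∀ s ω, F (w s ω) * aΦ s ω + Φ s ω * D1 s ω = 0 := by
    intro s ω
    by_cases hs : (s : WithTop ℝ≥0) ≤ σ ω
    · simp only [haΦdef, hD1def, hbwdef, hσwdef, hσBdef, hbXdef, haAdef, hwdef, hAdef, hΦdef, trunc_of_le hs]
      exact swallowObs_itoDrift_eq_zero κ (hYpos s ω) (hode (X s ω * (Y s ω)⁻¹))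
    · simp only [haΦdef, hD1def, hbwdef, hσwdef, hσBdef, hbXdef, haAdef, trunc_of_not_le hs]
      ring
  ---------------------------------------------------------------------------
  -- Step 6: `F(w) y^b = F(re z/im z)(im z)^b + K'` a.s.
  have hw0 : ∀ ω, w 0 ω = z.re / z.im := fun ω ↦ by
    simp only [hwdef, hAdef, hXdef, hYdef]
    rw [stoppedProcess_slePointRe_zero hz, stoppedProcess_slePointIm_zero hz, div_eq_mul_inv]
  have hae : ∀ᵐ ω ∂preWienerMeasure, ∀ t : ℝ≥0,
      F (w t ω) * Φ t ω = F (z.re / z.im) * z.im ^ b + K' t ω := by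
    filter_upwards [hprod] with ω hω t
    have h1 := hω t
    simp only [hdrift, intervalIntegral.integral_zero, add_zero, hw0, hΦ0] at h1
    exact h1
  -- the integrand of `K'` is `swallowObsDiffusion`
  have hint_eq : (fun t ω ↦ σG t ω * Φ t ω) = swallowObsDiffusion κ z σ F b := by
    funext t ω
    simp only [hσGdef, hσwdef, hΦdef, hwdef, hAdef, hσBdef, hXdef, hYdef, swallowObsDiffusion]
  refine ⟨K', hint_eq ▸ hK', hK'M, ?_⟩
  filter_upwards [hae] with ω hω t
  have h1 := hω t
  simp only [hwdef, hAdef, hΦdef, hXdef, hYdef] at h1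
  exact h1

/-- The observable is strongly adapted. [folklore] -/
theorem stronglyAdapted_swallowObs (hz : 0 < z.im) (hF : Continuous F)
    (hσ : IsStoppingTime brownianFiltration σ) :
    StronglyAdapted brownianFiltration (swallowObs κ z σ F b) := by
  intro t
  have hXa := stronglyAdapted_stoppedProcess_slePointRe (κ := κ) hz hσ t
  have hYa := stronglyAdapted_stoppedProcess_slePointIm (κ := κ) hz hσ t
  exact (hF.comp_stronglyMeasurable (hXa.mul hYa.measurable.inv.stronglyMeasurable)).mul
    (hYa.measurable.pow_const b).stronglyMeasurable

/-- The observable has continuous paths (`σ ≤ ρₙ`). [folklore] -/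
theorem continuous_swallowObs (hz : 0 < z.im) (hF : Continuous F)
    (hσρ : ∀ ω, σ ω ≤ slePointLocTime κ z n ω) (ω : ℝ≥0 → ℝ) :
    Continuous fun t ↦ swallowObs κ z σ F b t ω := by
  have hXc := continuous_stoppedProcess_slePointRe hz hσρ ω
  have hYc := continuous_stoppedProcess_slePointIm hz σ ω (κ := κ)
  have hYpos : ∀ t, 0 < stoppedProcess (slePointIm κ z) σ t ω := fun t ↦
    stoppedProcess_slePointIm_pos hz hσρ t ω
  exact (hF.comp (hXc.mul (hYc.inv₀ fun t ↦ (hYpos t).ne'))).mul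
    (hYc.rpow_const fun t ↦ Or.inl (hYpos t).ne')

/-- **The stopped observable is a martingale** (`exists_isItoIntegral_swallowObs`).
[cite: RohdeSchramm2005, Lemma 6.5 (proof)] -/
theorem martingale_swallowObs (hκ : 0 < κ) (hz : 0 < z.im) (hF : ContDiff ℝ 2 F)
    (hode : ∀ w : ℝ, (κ : ℝ) / 2 * (1 + w ^ 2) * iteratedDeriv 2 F w + 4 * w * deriv F w -
      2 * b * F w = 0)
    (hσ : IsStoppingTime brownianFiltration σ) (hσρ : ∀ ω, σ ω ≤ slePointLocTime κ z n ω)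
    {S : ℝ} (hS : ∀ (ω : ℝ≥0 → ℝ) (t : ℝ≥0), (t : WithTop ℝ≥0) ≤ σ ω →
      |cotArg (sleDriving κ ω) z t| ≤ S) :
    Martingale (swallowObs κ z σ F b) brownianFiltration preWienerMeasure := by
  obtain ⟨K, -, hKM, hae⟩ := exists_isItoIntegral_swallowObs hκ hz hF hode hσ hσρ hS
  have h1 : Martingale (fun t ω ↦ F (z.re / z.im) * z.im ^ b + K t ω) brownianFiltration preWienerMeasure :=
    (martingale_const brownianFiltration preWienerMeasure _).add hKM
  refine h1.congr (stronglyAdapted_swallowObs hz hF.continuous hσ) fun t ↦ ?_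
  filter_upwards [hae] with ω hω
  exact (hω t).symm

/-- **Constancy of the expectation**: `E[F(w_{t∧σ}) y^b_{t∧σ}] = F(re z/im z)(im z)^b`.
("`h(z₀) = E[h(z_{τ*})]`", Rohde–Schramm p. 907.) [cite: RohdeSchramm2005, Lemma 6.5 (proof)] -/
theorem integral_swallowObs (hκ : 0 < κ) (hz : 0 < z.im) (hF : ContDiff ℝ 2 F)
    (hode : ∀ w : ℝ, (κ : ℝ) / 2 * (1 + w ^ 2) * iteratedDeriv 2 F w + 4 * w * deriv F w -
      2 * b * F w = 0)
    (hσ : IsStoppingTime brownianFiltration σ) (hσρ : ∀ ω, σ ω ≤ slePointLocTime κ z n ω)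
    {S : ℝ} (hS : ∀ (ω : ℝ≥0 → ℝ) (t : ℝ≥0), (t : WithTop ℝ≥0) ≤ σ ω →
      |cotArg (sleDriving κ ω) z t| ≤ S) (t : ℝ≥0) :
    ∫ ω, swallowObs κ z σ F b t ω ∂preWienerMeasure = F (z.re / z.im) * z.im ^ b := by
  haveI := isProbabilityMeasure_preWienerMeasure'
  have h := integral_eq_of_martingale (martingale_swallowObs hκ hz hF hode hσ hσρ hS) t
  rw [h]
  simp only [swallowObs_zero hz, MeasureTheory.integral_const, smul_eq_mul, probReal_univ, one_mul]

/-! ### The diffusion coefficient: progressive and bounded -/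

/-- The diffusion coefficient `swallowObsDiffusion` is progressively measurable (`σ` a stopping
time `≤ ρₙ`, `F ∈ C¹`). [folklore] -/
theorem isStronglyProgressive_swallowObsDiffusion (hz : 0 < z.im) (hF1 : Continuous (deriv F))
    (hσ : IsStoppingTime brownianFiltration σ) (hσρ : ∀ ω, σ ω ≤ slePointLocTime κ z n ω) :
    IsStronglyProgressive brownianFiltration (swallowObsDiffusion κ z σ F b) := by
  have hσ' : ∀ t : ℝ≥0, MeasurableSet[brownianFiltration t] {ω | σ ω < t} :=
    fun t ↦ hσ.measurableSet_lt t
  have hYpos : ∀ t ω, 0 < stoppedProcess (slePointIm κ z) σ t ω := fun t ω ↦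
    stoppedProcess_slePointIm_pos hz hσρ t ω
  have hXa : StronglyAdapted brownianFiltration (stoppedProcess (slePointRe κ z) σ) :=
    stronglyAdapted_stoppedProcess_slePointRe hz hσ
  have hYa : StronglyAdapted brownianFiltration (stoppedProcess (slePointIm κ z) σ) :=
    stronglyAdapted_stoppedProcess_slePointIm hz hσ
  have hXp := hXa.isStronglyProgressive_of_continuous fun ω ↦ continuous_stoppedProcess_slePointRe hz hσρ ω
  have hAa : StronglyAdapted brownianFiltration fun t ω ↦ (stoppedProcess (slePointIm κ z) σ t ω)⁻¹ :=
    fun t ↦ (hYa t).measurable.inv.stronglyMeasurable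
  have hAp : IsStronglyProgressive brownianFiltration fun t ω ↦ (stoppedProcess (slePointIm κ z) σ t ω)⁻¹ :=
    hAa.isStronglyProgressive_of_continuous fun ω ↦
      (continuous_stoppedProcess_slePointIm hz σ ω).inv₀ fun t ↦ (hYpos t ω).ne'
  have hΦa : StronglyAdapted brownianFiltration fun t ω ↦ stoppedProcess (slePointIm κ z) σ t ω ^ b :=
    fun t ↦ ((hYa t).measurable.pow_const b).stronglyMeasurable
  have hΦp : IsStronglyProgressive brownianFiltration fun t ω ↦ stoppedProcess (slePointIm κ z) σ t ω ^ b :=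
    hΦa.isStronglyProgressive_of_continuous fun ω ↦
      (continuous_stoppedProcess_slePointIm hz σ ω).rpow_const fun t ↦ Or.inl (hYpos t ω).ne'
  have h1 : IsStronglyProgressive brownianFiltration (trunc σ (fun (_ : ℝ≥0) (_ : ℝ≥0 → ℝ) ↦ -Real.sqrt κ)) :=
    isStronglyProgressive_trunc (isStronglyProgressive_const _ _) hσ'
  have h2 : IsStronglyProgressive brownianFiltration fun t ω ↦
      deriv F (stoppedProcess (slePointRe κ z) σ t ω * (stoppedProcess (slePointIm κ z) σ t ω)⁻¹) :=
    IsStronglyProgressive.continuous_comp (hXp.mul hAp) hF1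
  exact ((h1.mul hAp).mul h2).mul hΦp

/-- The diffusion coefficient `swallowObsDiffusion` is uniformly bounded (`σ ≤ ρₙ`, bounded slope
on `[0, σ]`, `F ∈ C¹`). [folklore] -/
theorem exists_abs_swallowObsDiffusion_le (hz : 0 < z.im) (hF1 : Continuous (deriv F))
    (hσρ : ∀ ω, σ ω ≤ slePointLocTime κ z n ω)
    {S : ℝ} (hS : ∀ (ω : ℝ≥0 → ℝ) (t : ℝ≥0), (t : WithTop ℝ≥0) ≤ σ ω →
      |cotArg (sleDriving κ ω) z t| ≤ S) :
    ∃ C : ℝ, ∀ t ω, |swallowObsDiffusion κ z σ F b t ω| ≤ C := by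
  have hl0 : 0 < z.im / (n + 2) := (level_pos_lt hz n).1
  have hYpos : ∀ t ω, 0 < stoppedProcess (slePointIm κ z) σ t ω := fun t ω ↦
    stoppedProcess_slePointIm_pos hz hσρ t ω
  have hYlev : ∀ t ω, z.im / (n + 2) ≤ stoppedProcess (slePointIm κ z) σ t ω := fun t ω ↦
    level_le_stoppedProcess_slePointIm hz hσρ t ω
  have hYle : ∀ t ω, stoppedProcess (slePointIm κ z) σ t ω ≤ z.im := fun t ω ↦
    stoppedProcess_slePointIm_le hz hσρ t ω
  have hwS : ∀ t ω, |stoppedProcess (slePointRe κ z) σ t ω * (stoppedProcess (slePointIm κ z) σ t ω)⁻¹| ≤ S :=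
    fun t ω ↦ by
      rw [← div_eq_mul_inv, stopped_div_eq_cotArg hz hσρ t ω]
      exact hS ω _ (coe_untopA_min_le t (σ ω))
  obtain ⟨C1, hC1⟩ : ∃ C, ∀ v ∈ Icc (-S) S, |deriv F v| ≤ C := by
    obtain ⟨C, hC⟩ := isCompact_Icc.exists_bound_of_continuousOn hF1.continuousOn
    exact ⟨C, fun v hv ↦ by simpa [Real.norm_eq_abs] using hC v hv⟩
  set CΦ : ℝ := max (z.im ^ b) ((z.im / (n + 2)) ^ b) with hCΦdef
  have hΦbd : ∀ t ω, |stoppedProcess (slePointIm κ z) σ t ω ^ b| ≤ CΦ := fun t ω ↦ by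
    rw [abs_of_pos (Real.rpow_pos_of_pos (hYpos t ω) b)]
    rcases le_total 0 b with hb | hb
    · exact (Real.rpow_le_rpow (hYpos t ω).le (hYle t ω) hb).trans (le_max_left _ _)
    · exact (Real.rpow_le_rpow_of_nonpos hl0 (hYlev t ω) hb).trans (le_max_right _ _)
  have hAbd : ∀ t ω, |(stoppedProcess (slePointIm κ z) σ t ω)⁻¹| ≤ (n + 2) / z.im := fun t ω ↦ by
    rw [abs_of_pos (inv_pos.2 (hYpos t ω)), inv_eq_one_div, div_le_div_iff₀ (hYpos t ω) hz, one_mul]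
    have := hYlev t ω
    rw [div_le_iff₀ (by positivity : (0 : ℝ) < n + 2)] at this
    linarith
  refine ⟨Real.sqrt κ * ((n + 2) / z.im) * C1 * CΦ, fun t ω ↦ ?_⟩
  simp only [swallowObsDiffusion]
  rw [abs_mul, abs_mul, abs_mul]
  have h1 : |trunc σ (fun _ _ ↦ -Real.sqrt κ) t ω| ≤ Real.sqrt κ := by
    simp only [trunc_apply]
    split_ifs
    · rw [abs_neg, abs_of_nonneg (Real.sqrt_nonneg _)]
    · rw [abs_zero]; exact Real.sqrt_nonneg _
  have hC10 : 0 ≤ C1 := (abs_nonneg _).trans (hC1 _ (abs_le.1 (hwS t ω)))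
  exact mul_le_mul (mul_le_mul (mul_le_mul h1 (hAbd t ω) (abs_nonneg _) (Real.sqrt_nonneg _))
    (hC1 _ (abs_le.1 (hwS t ω))) (abs_nonneg _) (by positivity)) (hΦbd t ω) (abs_nonneg _) (by positivity)

/-! ### Second moment of the drift-free observable -/

/-- **`E[N_t²] = E ∫₀ᵗ D² ds` for a bounded, adapted, continuous, drift-free Itô process `N` with
`N₀ = 0` and bounded progressive diffusion coefficient `D`** (Itô's formula for `N²`: the drift is
`D²`, and the Itô integral of the bounded integrand `2ND` is a martingale vanishing at `0`).
Revuz–Yor (1999), Ch. IV, Thm (3.3). [cite: RevuzYor1999, Ch. IV Thm (3.3)] -/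
theorem integral_sq_eq_integral_timeIntegral_sq {N D : ℝ≥0 → (ℝ≥0 → ℝ) → ℝ}
    (hNa : StronglyAdapted brownianFiltration N) (hNc : ∀ ω, Continuous (N · ω))
    (hN0 : ∀ ω, N 0 ω = 0) {C : ℝ} (hNC : ∀ t ω, |N t ω| ≤ C)
    (hDp : IsStronglyProgressive brownianFiltration D) {CD : ℝ} (hDC : ∀ t ω, |D t ω| ≤ CD)
    (hN : IsItoProcess N 0 D brownian brownianFiltration preWienerMeasure) (t : ℝ≥0) :
    Integrable (fun ω ↦ ∫ s in (0 : ℝ)..t, D s.toNNReal ω ^ 2) preWienerMeasure ∧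
      ∫ ω, N t ω ^ 2 ∂preWienerMeasure = ∫ ω, (∫ s in (0 : ℝ)..t, D s.toNNReal ω ^ 2) ∂preWienerMeasure := by
  haveI := isProbabilityMeasure_preWienerMeasure'
  have hNp : IsStronglyProgressive brownianFiltration N := hNa.isStronglyProgressive_of_continuous hNc
  have hC0 : 0 ≤ C := (abs_nonneg _).trans (hNC 0 fun _ ↦ 0)
  have hCD0 : 0 ≤ CD := (abs_nonneg _).trans (hDC 0 fun _ ↦ 0)
  -- the Itô integral of `D · 2N`
  have hderiv : ∀ x : ℝ, deriv (fun v : ℝ ↦ v ^ 2) x = 2 * x := fun x ↦ by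
    simp
  have hider : ∀ x : ℝ, iteratedDeriv 2 (fun v : ℝ ↦ v ^ 2) x = 2 := fun x ↦ by
    rw [iteratedDeriv_succ, iteratedDeriv_one]
    have : deriv (fun v : ℝ ↦ v ^ 2) = fun v ↦ 2 * v := funext hderiv
    rw [this]
    simp
  have hint_eq : (fun t ω ↦ D t ω * deriv (fun v : ℝ ↦ v ^ 2) (N t ω)) = fun t ω ↦ D t ω * (2 * N t ω) := by
    funext t ω; rw [hderiv]
  obtain ⟨K, hK, hKM⟩ := exists_isItoIntegral_of_abs_le (hDp.mul ((isStronglyProgressive_const _ 2).mul hNp))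
    (C := CD * (2 * C)) fun t ω ↦ by
      rw [abs_mul, abs_mul, abs_two]
      exact mul_le_mul (hDC t ω) (mul_le_mul_of_nonneg_left (hNC t ω) zero_le_two) (by positivity) hCD0
  have hf : ContDiff ℝ 2 (Function.uncurry fun (_ : ℝ) (v : ℝ) ↦ v ^ 2) :=
    (contDiff_id.pow 2).comp contDiff_snd
  have hito := ito_formula_itoProcess_ae_holds (fun (_ : ℝ) (v : ℝ) ↦ v ^ 2) hf
    (fun t ↦ (hNa t).measurable) hDp hN (K := K) (by rw [hint_eq]; exact hK)
  -- a.s. `N_t² = ∫₀ᵗ D² + K_t`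
  have hae : ∀ᵐ ω ∂preWienerMeasure, ∀ t : ℝ≥0,
      N t ω ^ 2 = (∫ s in (0 : ℝ)..t, D s.toNNReal ω ^ 2) + K t ω := by
    filter_upwards [hito] with ω hω t
    have h1 := hω t
    simp only [deriv_const, zero_add, Pi.zero_apply, zero_mul, hider, hN0] at h1
    have h2 : ∫ s in (0 : ℝ)..t, 2⁻¹ * D s.toNNReal ω ^ 2 * 2 = ∫ s in (0 : ℝ)..t, D s.toNNReal ω ^ 2 :=
      intervalIntegral.integral_congr fun s _ ↦ by ring
    rw [h1, h2]
    ring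
  -- integrate: `E[K_t] = E[K_0] = 0`
  have hK0 : ∫ ω, K t ω ∂preWienerMeasure = 0 := by
    rw [integral_eq_of_martingale hKM t]
    simp [hK.apply_zero]
  have hNint : Integrable (fun ω ↦ N t ω ^ 2) preWienerMeasure := by
    refine Integrable.of_bound ((hNa t).measurable.mono (brownianFiltration.le t) le_rfl |>.pow_const 2
      |>.aestronglyMeasurable) (C ^ 2) (ae_of_all _ fun ω ↦ ?_)
    rw [Real.norm_eq_abs, abs_pow, sq_abs, ← sq_abs]
    exact pow_le_pow_left₀ (abs_nonneg _) (hNC t ω) 2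
  have hKint : Integrable (K t) preWienerMeasure := hKM.integrable t
  have heq : (fun ω ↦ ∫ s in (0 : ℝ)..t, D s.toNNReal ω ^ 2) =ᵐ[preWienerMeasure] fun ω ↦ N t ω ^ 2 - K t ω := by
    filter_upwards [hae] with ω hω
    rw [hω t]; ring
  refine ⟨(hNint.sub hKint).congr heq.symm, ?_⟩
  rw [integral_congr_ae heq, integral_sub hNint hKint, hK0, sub_zero]

/-- **Second moment of the observable**: under the hypotheses of `exists_isItoIntegral_swallowObs`,
if the observable is bounded (`|F(w_{t∧σ}) y^b_{t∧σ}| ≤ C`), then for every `t`,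
`E[(F(w_{t∧σ})y^b_{t∧σ} - F(re z/im z)(im z)^b)²] = E ∫₀ᵗ swallowObsDiffusion² ds`.
[cite: RohdeSchramm2005, Lemma 6.5 (proof)] -/
theorem integral_sq_sub_eq_integral_sq_swallowObsDiffusion (hκ : 0 < κ) (hz : 0 < z.im)
    (hF : ContDiff ℝ 2 F)
    (hode : ∀ w : ℝ, (κ : ℝ) / 2 * (1 + w ^ 2) * iteratedDeriv 2 F w + 4 * w * deriv F w -
      2 * b * F w = 0)
    (hσ : IsStoppingTime brownianFiltration σ) (hσρ : ∀ ω, σ ω ≤ slePointLocTime κ z n ω)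
    {S : ℝ} (hS : ∀ (ω : ℝ≥0 → ℝ) (t : ℝ≥0), (t : WithTop ℝ≥0) ≤ σ ω →
      |cotArg (sleDriving κ ω) z t| ≤ S)
    {C : ℝ} (hC : ∀ t ω, |swallowObs κ z σ F b t ω| ≤ C) (t : ℝ≥0) :
    Integrable (fun ω ↦ ∫ s in (0 : ℝ)..t, swallowObsDiffusion κ z σ F b s.toNNReal ω ^ 2) preWienerMeasure ∧
    ∫ ω, (swallowObs κ z σ F b t ω - F (z.re / z.im) * z.im ^ b) ^ 2 ∂preWienerMeasure =
      ∫ ω, (∫ s in (0 : ℝ)..t, swallowObsDiffusion κ z σ F b s.toNNReal ω ^ 2) ∂preWienerMeasure := by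
  obtain ⟨K, hK, hKM, hae⟩ := exists_isItoIntegral_swallowObs hκ hz hF hode hσ hσρ hS
  set N : ℝ≥0 → (ℝ≥0 → ℝ) → ℝ := fun t ω ↦ swallowObs κ z σ F b t ω - F (z.re / z.im) * z.im ^ b with hNdef
  have hNa : StronglyAdapted brownianFiltration N := fun t ↦
    (stronglyAdapted_swallowObs hz hF.continuous hσ t).sub stronglyMeasurable_const
  have hNc : ∀ ω, Continuous (N · ω) := fun ω ↦
    (continuous_swallowObs hz hF.continuous hσρ ω).sub continuous_const
  have hN0 : ∀ ω, N 0 ω = 0 := fun ω ↦ by simp only [hNdef, swallowObs_zero hz, sub_self]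
  have hC0 : 0 ≤ C := (abs_nonneg _).trans (hC 0 fun _ ↦ 0)
  have hNC : ∀ t ω, |N t ω| ≤ 2 * C := fun t ω ↦ by
    simp only [hNdef]
    have h1 := hC t ω
    have h2 := hC 0 ω
    rw [swallowObs_zero hz] at h2
    calc |swallowObs κ z σ F b t ω - F (z.re / z.im) * z.im ^ b|
        ≤ |swallowObs κ z σ F b t ω| + |F (z.re / z.im) * z.im ^ b| := abs_sub _ _
      _ ≤ 2 * C := by linarith
  -- `N` is a drift-free Itô process with diffusion coefficient `swallowObsDiffusion`
  have hN : IsItoProcess N 0 (swallowObsDiffusion κ z σ F b) brownian brownianFiltration preWienerMeasure := by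
    refine ⟨ae_of_all _ fun ω t ↦ ?_, K, hK, ?_⟩
    · exact integrableOn_zero
    · filter_upwards [hae] with ω hω t
      simp only [hNdef, Pi.zero_apply, intervalIntegral.integral_zero, add_zero, hω t, hω 0, hK.apply_zero]
      ring
  -- the diffusion coefficient is bounded and progressive
  have hc1 : Continuous (deriv F) := hF.continuous_deriv (by norm_num)
  obtain ⟨CD, hDC⟩ := exists_abs_swallowObsDiffusion_le (b := b) hz hc1 hσρ hS
  have hDp := isStronglyProgressive_swallowObsDiffusion (b := b) hz hc1 hσ hσρ
  have h := integral_sq_eq_integral_timeIntegral_sq hNa hNc hN0 hNC hDp hDC hN t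
  simpa only [hNdef] using h

end Main

end Literature.Probability.RandomPlanarGeometry
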